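import Literature.AnabelianGeometry.AbsoluteAnabelian.AbsTopIII.Reconstruction
import Literature.AnabelianGeometry.AbsoluteAnabelian.LocalUnramifiedQuotientH2
import Literature.AnabelianGeometry.AbsoluteAnabelian.ZHatCompletionFreeProcyclic
import Literature.AnabelianGeometry.AbsoluteAnabelian.AbsAnabProp121viiUnrCharTransportProofs
import Literature.AnabelianGeometry.AbsoluteAnabelian.SlimTransport
import HarnessLib

/-!
# [AbsTopIII] Cor. 1.10 (i)(b), group-theoretic content: the Frobenius quotient `G_k ↠ Ẑ` is
# characteristic — discharge of the named fact `AbsTopIII.Cor_1_10_i` (universe `0`)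

Mochizuki, *Topics in Absolute Anabelian Geometry III*, §1 Cor. 1.10 (i)(b) p. 42 (manuscript
pagination, lit key `paper:url-5493eb38cbb7`): "the natural surjection `G_k^ab ↠ G^unr ⥲ Ẑ`
determined by the Frobenius element"; Rmk. 1.9.4 pp. 38–39: the Frobenius element of
`G_k ↠ G_k^unr ≅ Ẑ` "may be characterized by an entirely group-theoretic algorithm" (hence is
preserved by arbitrary isomorphisms of profinite groups), via [AbsAnab] Prop. 1.2.1 (ii), (iv).

The named fact `AbsTopIII.Cor_1_10_i M` (`Reconstruction.lean`, abc-iut-L4-t1; FACT-LIST F-0394),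
relative to a model `M : CurveModel`, asks for an `MLFReconstructionAlgorithm` whose output
`frobQuot : G → Ẑ` is, on every curve of the model over an MLF, SURJECTIVE and INVARIANT under every
automorphism of the profinite group `G = G_k`.  This file PROVES it for every `M : CurveModel.{0}`:

* `exists_frobeniusQuotient_charZHat` — for a non-archimedean local field `F` of characteristic `0`, a
  continuous surjection `f : Γ_F ↠ Ẑ` (`Ẑ` = Mathlib's profinite completion of `ℤ`) killing the
  inertia group `Gal(F̄/F^nr)`, sending every arithmetic Frobenius to the topological generator
  `η(1)`, and satisfying `f ∘ ψ = f` for EVERY `ψ : Γ_F ≃ₜ* Γ_F`.  Construction: `Γ_F ⧸ Gal(F̄/F^nr)`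
  is free procyclic on the Frobenius (`isFreeProcyclic_quotient_galUnr`, abc-iut-L4-t16), hence
  `≃ₜ* Ẑ` (`IsFreeProcyclic.exists_continuousMulEquiv_zHatCompletion_apply`); invariance is
  [AbsAnab] Prop. 1.2.1 (ii) `ψ(I_F) = I_F` (`Prop121vii.map_absInertia_eq`, from
  `galoisMLF_iso_inertia_holds`) and (iv) "`ψ` carries Frobenius lifts to Frobenius lifts"
  (`Prop121vii.isFrobPow_one_map`, from `galoisMLF_iso_frobenius_holds`), plus density of the
  Frobenius in `Gal(F^nr/F)` (`dense_zpowers_mk_of_isFrobPow`).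
* `AbsTopIII.cor_1_10_i_holds : ∀ M : CurveModel.{0}, AbsTopIII.Cor_1_10_i M`.

HONEST SCOPE.  Only the EXISTENCE of an algorithm is typed by `Cor_1_10_i`; the witness used here
assigns to an abstract extension `E` the character `f_F ∘ e` for a CHOSEN identification
`e : E.gal ≃ₜ* Γ_F` with the absolute Galois group of a local field (when one exists; the trivial
character otherwise) — its independence of that choice up to the printed clauses IS the content
"the Frobenius quotient is group-theoretic/characteristic".  The fields of the output signature that
(i)(b) does not mention (cyclotomes, Kummer container, `k`, `K_X`, decomposition groups of closed
points) carry PLACEHOLDER values: Cor. 1.10 (i)(a) `H²(G_k, μ_Ẑ(G_k)) ≅ Ẑ` and the cohomological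
form of (i)(b) `H¹(G_k, μ_Ẑ(G_k)) ≅ G_k^ab` are the separate named facts `Cor_1_10_i_a` (F-1387) /
`Cor_1_10_i_b` (F-0347) of `CyclotomicSynchronization.lean`, and Cor. 1.10 (ii), (iii) are
`Cor_1_10_ii` (F-0395) / `Cor_1_10_iii` (F-0396) — NONE of them is addressed here.
DEGENERATE-WITNESS PASS: `Cor_1_10_i M` is NOT closable by the constant character
(`not_surjective_const_one_zHat`: `Ẑ` is nontrivial, so surjectivity fails) — the surjectivity
clause forces the genuine Frobenius quotient.
Universe `0` only (the [AbsAnab] Prop. 1.2.1 inputs bind `K : Type`), as for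
`galoisMLF_iso_unitImage_holds`.  Proof-only; classical local class field theory; nothing here
bears on [IUTchIII] Cor. 3.12 or takes a side.
-/

noncomputable section

open CategoryTheory Function
open ProfiniteGrp ProfiniteGrp.ProfiniteCompletion Topology

namespace Literature.AnabelianGeometry.AbsoluteAnabelian

open Field ValuativeRel
open Literature.NumberTheory.GaloisRepresentations
open Literature.NumberTheory.GaloisRepresentations.IsNonarchimedeanLocalField

/-! ### The Frobenius quotient character of a local field and its invariance -/

section LocalField

variable (F : Type) [Field F] [ValuativeRel F] [TopologicalSpace F] [IsNonarchimedeanLocalField F]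
  [CharZero F]

/-- **The Frobenius quotient `Γ_F ↠ Gal(F^nr/F) ⥲ Ẑ` is characteristic.**  For a non-archimedean
local field `F` of characteristic `0` there is a continuous surjective homomorphism
`f : Γ_F → Ẑ` with kernel containing `Gal(F̄/F^nr)`, value `η(1)` on every arithmetic Frobenius,
and `f (ψ g) = f g` for every automorphism `ψ` of the profinite group `Γ_F` ([AbsTopIII] Cor. 1.10
(i)(b) with Rmk. 1.9.4; invariance by [AbsAnab] Prop. 1.2.1 (ii), (iv)).
[cite: MochizukiAbsTopIII2015, Cor 1.10 (i) p.42] -/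
theorem exists_frobeniusQuotient_charZHat :
    ∃ f : absoluteGaloisGroup F →ₜ* completion (GrpCat.of (Multiplicative ℤ)),
      Surjective f ∧ galUnr F ≤ f.toMonoidHom.ker ∧
      (∀ σ : absoluteGaloisGroup F, IsFrobPow σ 1 →
        f σ = etaFn (GrpCat.of (Multiplicative ℤ)) (Multiplicative.ofAdd (1 : ℤ))) ∧
      ∀ (ψ : absoluteGaloisGroup F ≃ₜ* absoluteGaloisGroup F) (g : absoluteGaloisGroup F),
        f (ψ g) = f g := by
  classical
  -- the quotient `Q = Γ_F ⧸ Gal(F̄/F^nr)` and an arithmetic Frobenius `φ`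
  set N := galUnr F with hN
  obtain ⟨φ, hφ⟩ := exists_isFrobPow_holds (F := F) 1
  have hd := dense_zpowers_mk_of_isFrobPow hφ
  -- `Q ≃ₜ* Ẑ`, `φ̄ ↦ η(1)`
  obtain ⟨e, he⟩ :=
    (isFreeProcyclic_quotient_galUnr F).exists_continuousMulEquiv_zHatCompletion_apply hd
  -- the projection as a continuous homomorphism
  let π : absoluteGaloisGroup F →ₜ* (absoluteGaloisGroup F ⧸ N) :=
    { QuotientGroup.mk' N with continuous_toFun := QuotientGroup.continuous_mk }
  have hπ : ∀ g, π g = (QuotientGroup.mk g : absoluteGaloisGroup F ⧸ N) := fun _ => rfl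
  let f : absoluteGaloisGroup F →ₜ* completion (GrpCat.of (Multiplicative ℤ)) :=
    (e : (absoluteGaloisGroup F ⧸ N) →ₜ* completion (GrpCat.of (Multiplicative ℤ))).comp π
  have hf : ∀ g, f g = e (QuotientGroup.mk g) := fun _ => rfl
  refine ⟨f, ?_, ?_, ?_, ?_⟩
  · exact e.surjective.comp (QuotientGroup.mk'_surjective N)
  · intro g hg
    rw [MonoidHom.mem_ker]
    change f g = 1
    rw [hf, (QuotientGroup.eq_one_iff g).2 hg, map_one]
  · intro σ hσ
    rw [hf, mk_eq_mk_of_isFrobPow hσ hφ]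
    exact he
  · intro ψ
    -- `ψ` preserves the inertia group
    have hψN : ∀ g ∈ N, ψ g ∈ N := by
      intro g hg
      rw [hN, galUnr_eq_absInertia] at hg ⊢
      rw [← Prop121vii.map_absInertia_eq ψ]
      exact ⟨g, hg, rfl⟩
    -- `f ∘ ψ` factors through `Q`
    have hker : ∀ g ∈ N, (f.toMonoidHom.comp ψ.toMulEquiv.toMonoidHom) g = 1 := by
      intro g hg
      change f (ψ g) = 1
      rw [hf, (QuotientGroup.eq_one_iff _).2 (hψN g hg), map_one]
    let u : (absoluteGaloisGroup F ⧸ N) →* completion (GrpCat.of (Multiplicative ℤ)) :=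
      QuotientGroup.lift N (f.toMonoidHom.comp ψ.toMulEquiv.toMonoidHom) hker
    have hu : ∀ g, u (QuotientGroup.mk g) = f (ψ g) := fun _ => rfl
    have huc : Continuous u := by
      rw [QuotientGroup.isQuotientMap_mk N |>.continuous_iff]
      exact f.continuous.comp ψ.continuous
    -- `u` and `e` agree on the Frobenius, hence on the dense subgroup it generates, hence everywhere
    have hφψ : u (QuotientGroup.mk φ) = e (QuotientGroup.mk φ) := by
      rw [hu, hf, mk_eq_mk_of_isFrobPow (Prop121vii.isFrobPow_one_map ψ hφ) hφ]
    have hsub : (Subgroup.zpowers (QuotientGroup.mk φ : absoluteGaloisGroup F ⧸ N) : Set _) ⊆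
        {q | u q = e q} := by
      rintro _ ⟨k, rfl⟩
      change u ((QuotientGroup.mk φ) ^ k) = e ((QuotientGroup.mk φ) ^ k)
      rw [map_zpow, map_zpow, hφψ]
    have hclosed : IsClosed {q : absoluteGaloisGroup F ⧸ N | u q = e q} :=
      isClosed_eq huc e.continuous
    have hall : ∀ q, u q = e q := by
      intro q
      have : q ∈ {q : absoluteGaloisGroup F ⧸ N | u q = e q} := by
        rw [← hclosed.closure_subset_iff] at hsub
        exact hsub (hd.closure_eq ▸ Set.mem_univ q)
      exact this
    intro g
    rw [← hu, hall, ← hf]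

end LocalField

/-! ### Degenerate-witness pass: the constant character is not a witness -/

/-- `Ẑ` (Mathlib's profinite completion of `ℤ`) is nontrivial — it has an open subgroup of index `2`
(`ZHatCompletion.exists_isOpen_index`) — so the constant character `G → Ẑ`, `g ↦ 1`, is NOT
surjective: the surjectivity clause of `Cor_1_10_i` excludes the degenerate witness.
[cite: MochizukiAbsTopIII2015, Cor 1.10 (i) p.42] -/
theorem not_surjective_const_one_zHat (G : Type*) :
    ¬ Surjective (fun _ : G => (1 : completion (GrpCat.of (Multiplicative ℤ)))) := by
  intro h
  obtain ⟨H, -, hH⟩ := ZHatCompletion.exists_isOpen_index (n := 2) two_pos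
  have htop : H = ⊤ := by
    refine (Subgroup.eq_top_iff' H).2 fun x => ?_
    obtain ⟨g, hg⟩ := h x
    rw [← hg]
    exact one_mem H
  rw [htop, Subgroup.index_top] at hH
  exact absurd hH (by norm_num)

/-! ### The witness character on an abstract extension (choice of an MLF identification) -/

/-- For an abstract extension `E`, a continuous character `E.gal → Ẑ` which — WHENEVER `E.gal` is
isomorphic, as a topological group, to the absolute Galois group of some characteristic-`0`
non-archimedean local field — is surjective and invariant under every automorphism of the profinite
group `E.gal`: transport of `exists_frobeniusQuotient_charZHat` along a CHOSEN identification (the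
independence of the choice is again Prop. 1.2.1 (ii), (iv)); the trivial character when no such
identification exists. [cite: MochizukiAbsTopIII2015, Cor 1.10 (i) p.42] -/
theorem exists_frobQuot_of_extension (E : FundamentalExtension.{0}) :
    ∃ fE : E.gal →ₜ* completion (GrpCat.of (Multiplicative ℤ)),
      (∃ (F : Type) (_ : Field F) (_ : ValuativeRel F) (_ : TopologicalSpace F)
          (_ : IsNonarchimedeanLocalField F) (_ : CharZero F),
          Nonempty (E.gal ≃ₜ* absoluteGaloisGroup F)) →
        Surjective fE ∧ ∀ (ψ : E.gal ≃ₜ* E.gal) (g : E.gal), fE (ψ g) = fE g := by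
  classical
  by_cases h : ∃ (F : Type) (_ : Field F) (_ : ValuativeRel F) (_ : TopologicalSpace F)
      (_ : IsNonarchimedeanLocalField F) (_ : CharZero F), Nonempty (E.gal ≃ₜ* absoluteGaloisGroup F)
  · obtain ⟨F, _, _, _, _, _, ⟨e⟩⟩ := h
    obtain ⟨f, hsurj, -, -, hinv⟩ := exists_frobeniusQuotient_charZHat F
    refine ⟨f.comp (e : E.gal →ₜ* absoluteGaloisGroup F), fun _ => ⟨hsurj.comp e.surjective, ?_⟩⟩
    intro ψ g
    have key := hinv (e.symm.trans (ψ.trans e)) (e g)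
    change f (e (ψ (e.symm (e g)))) = f (e g) at key
    rw [e.symm_apply_apply] at key
    exact key
  · exact ⟨{ (1 : E.gal →* completion (GrpCat.of (Multiplicative ℤ))) with
        continuous_toFun := continuous_const }, fun h' => (h h').elim⟩

namespace AbsTopIII

/-! ### Curves of a model over an MLF: the Galois group is that of a local field -/

/-- For a curve `X` of a model `M` whose base field is an MLF ([AbsTopIII] Cor. 1.10 input, p. 41),
`G = (M.ext X).gal` is isomorphic as a topological group to the absolute Galois group of a
characteristic-`0` non-archimedean local field — namely `k = M.base X` itself with the valued
structure of a finite extension of `ℚ_p` (`FiniteExtension.isNonarchimedeanLocalField`) and the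
model identification `M.galIso X : G ≅ Gal(k̄/k)`. [cite: MochizukiAbsTopIII2015, Cor 1.10 p.41] -/
theorem CurveModel.exists_localField_gal_of_isMLF (M : CurveModel.{0}) (X : M.Curve)
    (hX : IsMLF (M.base X)) :
    ∃ (F : Type) (_ : Field F) (_ : ValuativeRel F) (_ : TopologicalSpace F)
      (_ : IsNonarchimedeanLocalField F) (_ : CharZero F),
      Nonempty ((M.ext X).gal ≃ₜ* absoluteGaloisGroup F) := by
  obtain ⟨p, hp, φ, hfin⟩ := hX.exists_padic
  letI : Algebra ℚ_[p] (M.base X) := φ.toAlgebra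
  haveI : Module.Finite ℚ_[p] (M.base X) := hfin
  haveI : IsNonarchimedeanLocalField ℚ_[p] := Padic.isNonarchimedeanLocalField_holds p
  letI := FiniteExtension.normedField ℚ_[p] (M.base X)
  letI := FiniteExtension.valuativeRel ℚ_[p] (M.base X)
  haveI : IsNonarchimedeanLocalField (M.base X) :=
    FiniteExtension.isNonarchimedeanLocalField ℚ_[p] (M.base X)
  exact ⟨M.base X, inferInstance, inferInstance, inferInstance, inferInstance, inferInstance,
    nonempty_continuousMulEquiv_of_iso (M.galIso X)⟩

/-! ### Cor. 1.10 (i)(b): the named fact, universe `0` -/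

/-- **[AbsTopIII] Cor. 1.10 (i)(b) — the named fact `Cor_1_10_i M` HOLDS for every model
`M : CurveModel.{0}`**: there is an `MLFReconstructionAlgorithm` whose Frobenius quotient
`frobQuot : G → Ẑ` is, on every curve of `M` over an MLF `k`, SURJECTIVE ("`G_k^ab ↠ G^unr ⥲ Ẑ`")
and INVARIANT under every automorphism of the profinite group `G = G_k` (Rmk. 1.9.4: "may be
characterized by an entirely group-theoretic algorithm").  Witness: `frobQuot E` = the Frobenius
quotient character of a local field transported along a chosen identification of `E.gal`
(`exists_frobQuot_of_extension`); the other output fields (cyclotomes, Kummer container, `k`, `K_X`,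
decomposition groups — items (a), (c), (d), (ii), (iii), NOT asserted by this fact) are placeholders.
Universe `0` (reach of the [AbsAnab] Prop. 1.2.1 inputs). [cite: MochizukiAbsTopIII2015, Cor 1.10 (i) p.42] -/
theorem cor_1_10_i_holds (M : CurveModel.{0}) :
    Literature.AnabelianGeometry.AbsoluteAnabelian.AbsTopIII.Cor_1_10_i M := by
  classical
  choose fE hfE using exists_frobQuot_of_extension
  refine ⟨{ obj := fun E =>
              { galCyclotome := PUnit
                arithCyclotome := PUnit
                cycloSync := AddEquiv.refl PUnit
                frobQuot := fE E
                H1 := ℚˣ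
                baseField := ℚ
                kummerBase := MonoidHom.id ℚˣ
                kummerBase_injective := fun _ _ h => h
                functionField := ℚ
                closedPointDecomp := ∅ }
            map := fun _ => ⟨RingEquiv.refl ℚ, RingEquiv.refl ℚ, fun _ => rfl⟩
            map_id := fun _ => rfl
            map_comp := fun _ _ => rfl
            comap := fun _ _ => RingHom.id ℚ
            comap_map := fun _ _ _ => rfl }, ?_⟩
  intro X hX
  exact hfE (M.ext X) (CurveModel.exists_localField_gal_of_isMLF M X hX)

end AbsTopIII

end Literature.AnabelianGeometry.AbsoluteAnabelian

end
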